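import Summits.NavierStokesRegularity.NavierStokesRegularity.Theorems.AdaptedFrequencyAdaptedFrequencyConvergesLimitTwoReturns

/-!
# The adapted frequency converges to `2` in logarithmic Cesàro mean; its total defect is bounded
(crux stmt-NavierStokesRegularity-10493 `AdaptedFrequency.AdaptedFrequencyConverges`; rung of line
`birkhoff-recurrent-hull`, lands `--supports stmt-NavierStokesRegularity-10493`; lead c20)

Under the hypotheses of the crux (classical NS on `ℝ³ × [0,T)`, Leray–Hopf from a rapidly decaying
datum, Type-I rate, `(T, x₀)` backward-singular, `G` a Gaussian-comparable flow-adapted backward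
kernel on `[t₀, T)`), with `H = adaptedEnstrophy u G`, `Λ = adaptedFrequency u G T`
(`Λ t = (T − t) H′(t)/H(t)`) and the similarity time `s = −log (T − t)` (`ds = dt/(T − t)`):

* `frequency_defect_le` — **bounded total defect**: on a final window,
  `|∫_t^{t'} (Λ(τ) − 2) dτ/(T − τ)| ≤ L` for ALL late `t ≤ t'`, with one constant
  `L = log (C₁/c₀)` (ceiling over floor of the pinched quantity `(T − t)² H`);
* `frequency_logCesaro_tendsto_two` — **the crux holds in logarithmic Cesàro mean**: for every late
  base time `t`, `(∫_t^{t'} Λ(τ) dτ/(T − τ)) / log((T − t)/(T − t')) → 2` as `t' ↑ T`, i.e. the mean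
  of `Λ` over `[s, s']` in similarity time tends to the backward-self-similar value `2` (at rate
  `L/(s' − s)`); `logCesaro_tendsto_two_inline` is the same with the crux's hypotheses verbatim.

So what the crux asks beyond what is proved here is exactly the passage from Cesàro to pointwise
convergence of a bounded continuous `Λ` (c19: `frequency_abs_le`, `continuousOn_frequency`) whose
signed excursions have uniformly bounded integral — the breather/`λ`-DSS obstruction
(`…OfNoRecurrentPinchedPair`, `…LimitTwoReturns`).

Mechanism (pure real analysis over the landed pinched `C²` window `LimitTwo.pinchedWindow` =
stubs `stub_pinchingLower` p82804, `stub_pinchingUpper` p78510, `stub_enstrophyC2` p103653):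
`Λ(τ)/(T − τ) = H′(τ)/H(τ) = (log H)′(τ)`, so `∫_t^{t'} Λ dτ/(T − τ) = log H(t') − log H(t)`
(`integral_frequency_div_eq`, fundamental theorem of calculus), and
`∫_t^{t'} (Λ − 2) dτ/(T − τ) = log((T − t')² H(t')) − log((T − t)² H(t)) ∈ [−L, L]`
(`integral_frequency_sub_two_div_eq`, `abs_integral_frequency_sub_two_div_le`). On the disprover's
linear bench (`Cruxes/AdaptedFrequencyConverges/Disproof.lean` §4: no floor, `Λ = 2ε cos log(1−t)`)
the Cesàro mean is `0`, not `2`: the rung consumes the far-field input through the floor `c₀`.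
-/

noncomputable section

open scoped Topology
open Literature.Analysis.FluidPDE Set Filter MeasureTheory
open Summit.NavierStokesRegularity.NavierStokesRegularity.Theses.AdaptedFrequency

set_option linter.dupNamespace false

namespace Summit.NavierStokesRegularity.NavierStokesRegularity.Theorems.AdaptedFrequencyConverges.LimitTwo

/-! ### Real-analysis core: the frequency is the logarithmic derivative of `H` in similarity time -/

/-- **`∫ Λ ds = log H(t') − log H(t)`.** For `H` of class `C²` and positive on `(a, T)` and
`a < t ≤ t' < T`: `∫_t^{t'} ((T − τ) H′(τ)/H(τ)) / (T − τ) dτ = log H(t') − log H(t)`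
(fundamental theorem of calculus for `log ∘ H`). -/
theorem integral_frequency_div_eq {H : ℝ → ℝ} {a T t t' : ℝ}
    (hC2 : ContDiffOn ℝ 2 H (Ioo a T)) (hpos : ∀ τ ∈ Ioo a T, 0 < H τ)
    (hat : a < t) (htt' : t ≤ t') (ht'T : t' < T) :
    ∫ τ in t..t', ((T - τ) * deriv H τ / H τ) / (T - τ) = Real.log (H t') - Real.log (H t) := by
  have hsub : uIcc t t' ⊆ Ioo a T := by
    rw [uIcc_of_le htt']
    exact fun τ hτ => ⟨hat.trans_le hτ.1, hτ.2.trans_lt ht'T⟩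
  have hdiff : DifferentiableOn ℝ H (Ioo a T) := hC2.differentiableOn (by norm_num)
  have hder : ∀ τ ∈ uIcc t t',
      HasDerivAt (fun σ => Real.log (H σ)) (deriv H τ / H τ) τ := by
    intro τ hτ
    have hτ' := hsub hτ
    have h1 : HasDerivAt H (deriv H τ) τ :=
      (hdiff.differentiableAt (Ioo_mem_nhds hτ'.1 hτ'.2)).hasDerivAt
    exact h1.log (hpos τ hτ').ne'
  have hcont : ContinuousOn (fun τ => deriv H τ / H τ) (Ioo a T) :=
    (hC2.continuousOn_deriv_of_isOpen isOpen_Ioo (by norm_num)).div hC2.continuousOn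
      fun τ hτ => (hpos τ hτ).ne'
  have hint : IntervalIntegrable (fun τ => deriv H τ / H τ) volume t t' :=
    (hcont.mono hsub).intervalIntegrable
  have key := intervalIntegral.integral_eq_sub_of_hasDerivAt hder hint
  have hcongr : ∫ τ in t..t', ((T - τ) * deriv H τ / H τ) / (T - τ) =
      ∫ τ in t..t', deriv H τ / H τ := by
    refine intervalIntegral.integral_congr fun τ hτ => ?_
    have hTτ : T - τ ≠ 0 := (sub_pos.2 (hsub hτ).2).ne'
    show (T - τ) * deriv H τ / H τ / (T - τ) = deriv H τ / H τ
    rw [mul_div_assoc, mul_div_cancel_left₀ _ hTτ]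
  rw [hcongr, key]

/-- **`∫ (Λ − 2) ds = log h(t') − log h(t)`, `h = (T − ·)² H`.** For `H` of class `C²` and positive
on `(a, T)` and `a < t ≤ t' < T`:
`∫_t^{t'} ((T − τ) H′/H − 2) / (T − τ) dτ = log((T − t')² H(t')) − log((T − t)² H(t))`. -/
theorem integral_frequency_sub_two_div_eq {H : ℝ → ℝ} {a T t t' : ℝ}
    (hC2 : ContDiffOn ℝ 2 H (Ioo a T)) (hpos : ∀ τ ∈ Ioo a T, 0 < H τ)
    (hat : a < t) (htt' : t ≤ t') (ht'T : t' < T) :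
    ∫ τ in t..t', ((T - τ) * deriv H τ / H τ - 2) / (T - τ) =
      Real.log ((T - t') ^ 2 * H t') - Real.log ((T - t) ^ 2 * H t) := by
  have hsub : uIcc t t' ⊆ Ioo a T := by
    rw [uIcc_of_le htt']
    exact fun τ hτ => ⟨hat.trans_le hτ.1, hτ.2.trans_lt ht'T⟩
  have hdiff : DifferentiableOn ℝ H (Ioo a T) := hC2.differentiableOn (by norm_num)
  have hder : ∀ τ ∈ uIcc t t', HasDerivAt (fun σ => Real.log (H σ) + 2 * Real.log (T - σ))
      (deriv H τ / H τ - 2 / (T - τ)) τ :=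
    fun τ hτ => hasDerivAt_logClock hdiff hpos (hsub hτ)
  have hcont : ContinuousOn (fun τ => deriv H τ / H τ - 2 / (T - τ)) (Ioo a T) := by
    refine ((hC2.continuousOn_deriv_of_isOpen isOpen_Ioo (by norm_num)).div hC2.continuousOn
      fun τ hτ => (hpos τ hτ).ne').sub ?_
    exact continuousOn_const.div (continuousOn_const.sub continuousOn_id)
      fun τ hτ => (sub_pos.2 hτ.2).ne'
  have hint : IntervalIntegrable (fun τ => deriv H τ / H τ - 2 / (T - τ)) volume t t' :=
    (hcont.mono hsub).intervalIntegrable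
  have key := intervalIntegral.integral_eq_sub_of_hasDerivAt hder hint
  have hcongr : ∫ τ in t..t', ((T - τ) * deriv H τ / H τ - 2) / (T - τ) =
      ∫ τ in t..t', (deriv H τ / H τ - 2 / (T - τ)) := by
    refine intervalIntegral.integral_congr fun τ hτ => ?_
    have hTτ : T - τ ≠ 0 := (sub_pos.2 (hsub hτ).2).ne'
    show ((T - τ) * deriv H τ / H τ - 2) / (T - τ) = deriv H τ / H τ - 2 / (T - τ)
    rw [sub_div, mul_div_assoc, mul_div_cancel_left₀ _ hTτ]
  rw [hcongr, key, log_sq_mul ht'T (hpos t' ⟨hat.trans_le htt', ht'T⟩),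
    log_sq_mul (htt'.trans_lt ht'T) (hpos t ⟨hat, htt'.trans_lt ht'T⟩)]

/-- **Bounded total defect (real-analysis form).** If `H` is `C²` on `(a, T)` and two-sided pinched
there, `0 < c₀ ≤ (T − τ)² H(τ) ≤ C₁`, then for all `a < t ≤ t' < T`:
`|∫_t^{t'} ((T − τ) H′/H − 2) / (T − τ) dτ| ≤ log (C₁/c₀)`. -/
theorem abs_integral_frequency_sub_two_div_le {H : ℝ → ℝ} {a T c₀ C₁ t t' : ℝ}
    (hC2 : ContDiffOn ℝ 2 H (Ioo a T)) (hc₀ : 0 < c₀)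
    (hpinch : ∀ τ ∈ Ioo a T, c₀ ≤ (T - τ) ^ 2 * H τ ∧ (T - τ) ^ 2 * H τ ≤ C₁)
    (hat : a < t) (htt' : t ≤ t') (ht'T : t' < T) :
    |∫ τ in t..t', ((T - τ) * deriv H τ / H τ - 2) / (T - τ)| ≤ Real.log (C₁ / c₀) := by
  have hpos : ∀ τ ∈ Ioo a T, 0 < H τ := pos_of_lowerPinching hc₀ fun τ hτ => (hpinch τ hτ).1
  rw [integral_frequency_sub_two_div_eq hC2 hpos hat htt' ht'T]
  have ht : t ∈ Ioo a T := ⟨hat, htt'.trans_lt ht'T⟩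
  have ht' : t' ∈ Ioo a T := ⟨hat.trans_le htt', ht'T⟩
  have hC₁ : 0 < C₁ := hc₀.trans_le ((hpinch t ht).1.trans (hpinch t ht).2)
  have hlo : ∀ τ ∈ Ioo a T, Real.log c₀ ≤ Real.log ((T - τ) ^ 2 * H τ) :=
    fun τ hτ => Real.log_le_log hc₀ (hpinch τ hτ).1
  have hhi : ∀ τ ∈ Ioo a T, Real.log ((T - τ) ^ 2 * H τ) ≤ Real.log C₁ :=
    fun τ hτ => Real.log_le_log (hc₀.trans_le (hpinch τ hτ).1) (hpinch τ hτ).2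
  rw [Real.log_div hC₁.ne' hc₀.ne', abs_sub_le_iff]
  constructor
  · linarith [hlo t ht, hhi t' ht']
  · linarith [hlo t' ht', hhi t ht]

/-- The logarithmic length `log((T − t)/(T − t'))` of a late window tends to `+∞` as `t' ↑ T`. -/
theorem tendsto_logLength_atTop {T t : ℝ} (htT : t < T) :
    Tendsto (fun t' => Real.log ((T - t) / (T - t'))) (𝓝[<] T) atTop := by
  have h1 : Tendsto (fun t' : ℝ => T - t') (𝓝[<] T) (𝓝[>] 0) := by
    refine tendsto_nhdsWithin_iff.2 ⟨?_, ?_⟩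
    · have : Tendsto (fun t' : ℝ => T - t') (𝓝 T) (𝓝 (T - T)) :=
        (continuous_const.sub continuous_id).tendsto T
      rw [sub_self] at this
      exact this.mono_left nhdsWithin_le_nhds
    · filter_upwards [self_mem_nhdsWithin] with t' ht'
      exact sub_pos.2 (show t' < T from ht')
  have h2 : Tendsto (fun t' : ℝ => (T - t')⁻¹) (𝓝[<] T) atTop :=
    tendsto_inv_nhdsGT_zero.comp h1
  have h3 : Tendsto (fun t' : ℝ => (T - t) * (T - t')⁻¹) (𝓝[<] T) atTop :=
    h2.const_mul_atTop (sub_pos.2 htT)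
  exact Real.tendsto_log_atTop.comp h3

/-- **Logarithmic Cesàro convergence to `2` (real-analysis form).** If `H` is `C²` on `(a, T)` and
two-sided pinched there (`0 < c₀ ≤ (T − τ)² H ≤ C₁`), then for every base time `t ∈ (a, T)` the mean
of the frequency in similarity time over `[t, t']`,
`(∫_t^{t'} ((T − τ) H′/H)/(T − τ) dτ) / log((T − t)/(T − t'))`, tends to `2` as `t' ↑ T`
(the error is at most `log(C₁/c₀) / log((T − t)/(T − t'))`). -/
theorem tendsto_logCesaro_frequency {H : ℝ → ℝ} {a T c₀ C₁ t : ℝ}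
    (hC2 : ContDiffOn ℝ 2 H (Ioo a T)) (hc₀ : 0 < c₀)
    (hpinch : ∀ τ ∈ Ioo a T, c₀ ≤ (T - τ) ^ 2 * H τ ∧ (T - τ) ^ 2 * H τ ≤ C₁)
    (ht : t ∈ Ioo a T) :
    Tendsto (fun t' => (∫ τ in t..t', ((T - τ) * deriv H τ / H τ) / (T - τ)) /
      Real.log ((T - t) / (T - t'))) (𝓝[<] T) (𝓝 2) := by
  have hpos : ∀ τ ∈ Ioo a T, 0 < H τ := pos_of_lowerPinching hc₀ fun τ hτ => (hpinch τ hτ).1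
  have hSat : Tendsto (fun t' => Real.log ((T - t) / (T - t'))) (𝓝[<] T) atTop :=
    tendsto_logLength_atTop ht.2
  -- on the late window `(t, T)`: the Cesàro error is `(log h t' − log h t) / S` with `|…| ≤ L / S`
  have hbound : ∀ᶠ t' in 𝓝[<] T,
      ‖(∫ τ in t..t', ((T - τ) * deriv H τ / H τ) / (T - τ)) / Real.log ((T - t) / (T - t')) - 2‖
        ≤ Real.log (C₁ / c₀) / Real.log ((T - t) / (T - t')) := by
    filter_upwards [Ioo_mem_nhdsLT ht.2, hSat.eventually (eventually_gt_atTop 0)] with t' ht' hSt'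
    have htt' : t ≤ t' := ht'.1.le
    have hI := integral_frequency_div_eq hC2 hpos ht.1 htt' ht'.2
    have hD := integral_frequency_sub_two_div_eq hC2 hpos ht.1 htt' ht'.2
    have hA := abs_integral_frequency_sub_two_div_le hC2 hc₀ hpinch ht.1 htt' ht'.2
    have hTt : 0 < T - t := sub_pos.2 ht.2
    have hTt' : 0 < T - t' := sub_pos.2 ht'.2
    set S : ℝ := Real.log ((T - t) / (T - t')) with hS
    have hSval : S = Real.log (T - t) - Real.log (T - t') := by
      rw [hS]
      exact Real.log_div hTt.ne' hTt'.ne'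
    rw [hI]
    -- the Cesàro error in closed form
    have hkey : (Real.log (H t') - Real.log (H t)) / S - 2 =
        (Real.log ((T - t') ^ 2 * H t') - Real.log ((T - t) ^ 2 * H t)) / S := by
      rw [eq_div_iff hSt'.ne', sub_mul, div_mul_cancel₀ _ hSt'.ne', hSval,
        log_sq_mul ht'.2 (hpos t' ⟨ht.1.trans ht'.1, ht'.2⟩), log_sq_mul ht.2 (hpos t ht)]
      ring
    rw [hkey, Real.norm_eq_abs, abs_div, abs_of_pos hSt', ← hD]
    exact div_le_div_of_nonneg_right hA hSt'.le
  have hlim : Tendsto (fun t' => Real.log (C₁ / c₀) / Real.log ((T - t) / (T - t'))) (𝓝[<] T)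
      (𝓝 0) := tendsto_const_nhds.div_atTop hSat
  have h0 := squeeze_zero_norm' hbound hlim
  simpa using h0.add_const 2

/-! ### The rung under the crux hypotheses (tree vocabulary) -/

section Crux

variable {ν T t₀ : ℝ} {u : ℝ → EuclideanSpace ℝ (Fin 3) → EuclideanSpace ℝ (Fin 3)}
  {p : ℝ → EuclideanSpace ℝ (Fin 3) → ℝ} {x₀ : EuclideanSpace ℝ (Fin 3)}
  {G : ℝ → EuclideanSpace ℝ (Fin 3) → ℝ}

/-- **Bounded total defect of the adapted frequency.** Under the crux hypotheses there are a final
window `[t₂, T)` and `L ≥ 0` such that for all `t₂ < t ≤ t' < T`,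
`|∫_t^{t'} (Λ(τ) − 2) dτ/(T − τ)| ≤ L`: in similarity time `s = −log(T − t)` the signed excursions
of `Λ` about the self-similar value `2` have uniformly bounded integral over every late window
(`L = log(C₁/c₀)`, ceiling over floor of `(T − t)² H`). -/
theorem frequency_defect_le (hν : 0 < ν) (hT : 0 < T)
    (hcl : IsClassicalNSSolutionOn (Ico 0 T) ν 0 u p) (hLH : IsLerayHopfOn T ν 0 (u 0) u)
    (hdec : HasRapidSpatialDecay (u 0)) (hTI : IsTypeIBlowup u T) (ht₀ : t₀ ∈ Ico 0 T)
    (hsing : ∀ r : ℝ, 0 < r →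
      eLpNorm (Function.uncurry u) ⊤ (volume.restrict (parabolicCylinder r (T, x₀))) = ⊤)
    (hker : IsAdaptedBackwardKernel ν u (Ico t₀ T) T x₀ G)
    (hcmp : IsGaussianComparable G (Ico t₀ T) T x₀) :
    ∃ t₂ ∈ Ico t₀ T, ∃ L : ℝ, 0 ≤ L ∧ ∀ t t' : ℝ, t₂ < t → t ≤ t' → t' < T →
      |∫ τ in t..t', (adaptedFrequency u G T τ - 2) / (T - τ)| ≤ L := by
  obtain ⟨a, c₀, C₁, ht₀a, haT, hc₀, hC2, hpinch⟩ :=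
    pinchedWindow hν hT hcl hLH hdec hTI ht₀ hsing hker hcmp
  have hm : (a + T) / 2 ∈ Ioo a T := ⟨by linarith, by linarith⟩
  have hcC : c₀ ≤ C₁ := (hpinch _ hm).1.trans (hpinch _ hm).2
  have hL : 0 ≤ Real.log (C₁ / c₀) := Real.log_nonneg ((one_le_div hc₀).2 hcC)
  refine ⟨a, ⟨ht₀a, haT⟩, Real.log (C₁ / c₀), hL, fun t t' hat htt' ht'T => ?_⟩
  exact abs_integral_frequency_sub_two_div_le hC2 hc₀ hpinch hat htt' ht'T

/-- **The crux holds in logarithmic Cesàro mean.** Under the crux hypotheses there is a final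
window `[t₂, T)` such that for every base time `t ∈ (t₂, T)` the similarity-time mean of the adapted
frequency over `[t, t']`, `(∫_t^{t'} Λ(τ) dτ/(T − τ)) / log((T − t)/(T − t'))`, tends to `2` as
`t' ↑ T`. (The crux `AdaptedFrequencyConverges` asks for the pointwise limit, which by
`limit_eq_two` can only be `2`.) -/
theorem frequency_logCesaro_tendsto_two (hν : 0 < ν) (hT : 0 < T)
    (hcl : IsClassicalNSSolutionOn (Ico 0 T) ν 0 u p) (hLH : IsLerayHopfOn T ν 0 (u 0) u)
    (hdec : HasRapidSpatialDecay (u 0)) (hTI : IsTypeIBlowup u T) (ht₀ : t₀ ∈ Ico 0 T)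
    (hsing : ∀ r : ℝ, 0 < r →
      eLpNorm (Function.uncurry u) ⊤ (volume.restrict (parabolicCylinder r (T, x₀))) = ⊤)
    (hker : IsAdaptedBackwardKernel ν u (Ico t₀ T) T x₀ G)
    (hcmp : IsGaussianComparable G (Ico t₀ T) T x₀) :
    ∃ t₂ ∈ Ico t₀ T, ∀ t ∈ Ioo t₂ T,
      Tendsto (fun t' => (∫ τ in t..t', adaptedFrequency u G T τ / (T - τ)) /
        Real.log ((T - t) / (T - t'))) (𝓝[<] T) (𝓝 2) := by
  obtain ⟨a, c₀, C₁, ht₀a, haT, hc₀, hC2, hpinch⟩ :=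
    pinchedWindow hν hT hcl hLH hdec hTI ht₀ hsing hker hcmp
  refine ⟨a, ⟨ht₀a, haT⟩, fun t ht => ?_⟩
  exact tendsto_logCesaro_frequency hC2 hc₀ hpinch ht

end Crux

/-! ### The same in the crux's own (inline) vocabulary -/

/-- **The crux holds in logarithmic Cesàro mean — crux vocabulary.** With the hypotheses of
`AdaptedFrequency.AdaptedFrequencyConverges` spelled verbatim (the five kernel clauses and the
two-sided Gaussian comparability inline, `H t = ∫ ‖curl (u t) x‖² G t x`,
`Λ t = (T − t) · deriv H t / H t`): there is a final window `[t₂, T)` such that for every base time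
`t ∈ (t₂, T)`, `(∫_t^{t'} Λ(τ) dτ/(T − τ)) / log((T − t)/(T − t')) → 2` as `t' ↑ T`. -/
theorem logCesaro_tendsto_two_inline : ∀ (ν T : ℝ), 0 < ν → 0 < T → ∀ (u : ℝ → EuclideanSpace ℝ (Fin 3) → EuclideanSpace ℝ (Fin 3)) (p : ℝ → EuclideanSpace ℝ (Fin 3) → ℝ), Literature.Analysis.FluidPDE.IsClassicalNSSolutionOn (Set.Ico 0 T) ν 0 u p → Literature.Analysis.FluidPDE.IsLerayHopfOn T ν 0 (u 0) u → Literature.Analysis.FluidPDE.HasRapidSpatialDecay (u 0) → Literature.Analysis.FluidPDE.IsTypeIBlowup u T → ∀ (x₀ : EuclideanSpace ℝ (Fin 3)) (t₀ : ℝ) (G : ℝ → EuclideanSpace ℝ (Fin 3) → ℝ), t₀ ∈ Set.Ico 0 T → (∀ r : ℝ, 0 < r → MeasureTheory.eLpNorm (Function.uncurry u) ⊤ (MeasureTheory.Measure.restrict MeasureTheory.volume (Literature.Analysis.FluidPDE.parabolicCylinder r (T, x₀))) = ⊤) → ContDiffOn ℝ 2 (Function.uncurry G) (Set.Ico t₀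 T ×ˢ Set.univ) ∧ (∀ t ∈ Set.Ico t₀ T, ∀ x, 0 < G t x) ∧ (∀ t ∈ Set.Ico t₀ T, ∀ x, Literature.Analysis.FluidPDE.timeDerivWithin (Set.Ico t₀ T) G t x + fderiv ℝ (G t) x (u t x) + ν * Laplacian.laplacian (G t) x = 0) ∧ (∀ t ∈ Set.Ico t₀ T, ∫ x, G t x = 1) ∧ (∀ φ : EuclideanSpace ℝ (Fin 3) → ℝ, Continuous φ → (∃ M : ℝ, ∀ x, |φ x| ≤ M) → Filter.Tendsto (fun t => ∫ x, φ x * G t x) (nhdsWithin T (Set.Iio T)) (nhds (φ x₀))) → (∃ c₁ c₂ C₁ C₂ : ℝ, 0 < c₁ ∧ 0 < c₂ ∧ 0 < C₁ ∧ 0 < C₂ ∧ ∀ t ∈ Set.Ico t₀ T, ∀ x, c₁ * (T - t) ^ (-(3:ℝ) / 2) * Real.exp (-(‖x - x₀‖ ^ 2) / (c₂ * (T - t))) ≤ G t x ∧ G t x ≤ C₁ * (T - t) ^ (-(3:ℝ) / 2) * Real.exp (-(‖x - x₀‖ ^ 2) / (C₂ * (T - t)))) → ∀ H Λ : ℝ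 → ℝ, H = (fun t => ∫ x, ‖Literature.Analysis.FluidPDE.curl (u t) x‖ ^ 2 * G t x) → Λ = (fun t => (T - t) * deriv H t / H t) → ∃ t₂ ∈ Set.Ico t₀ T, ∀ t ∈ Set.Ioo t₂ T, Filter.Tendsto (fun t' => (∫ τ in t..t', Λ τ / (T - τ)) / Real.log ((T - t) / (T - t'))) (nhdsWithin T (Set.Iio T)) (nhds 2) := by
  intro ν T hν hT u p hcl hLH hdec hTI x₀ t₀ G ht₀ hsing hK hcomp H Λ hH hΛ
  have hker : IsAdaptedBackwardKernel ν u (Ico t₀ T) T x₀ G := isAdaptedBackwardKernel_iff.2 hK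
  have hcmp : IsGaussianComparable G (Ico t₀ T) T x₀ := isGaussianComparable_iff_fin_three.2 hcomp
  have hH' : H = adaptedEnstrophy u G := by
    rw [hH]; funext t; rfl
  have hΛ' : Λ = adaptedFrequency u G T := by
    rw [hΛ, hH']; funext t; rfl
  rw [hΛ']
  exact frequency_logCesaro_tendsto_two hν hT hcl hLH hdec hTI ht₀ hsing hker hcmp

end Summit.NavierStokesRegularity.NavierStokesRegularity.Theorems.AdaptedFrequencyConverges.LimitTwo

end
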